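import Literature.NumberTheory.Automorphic.Liu2021.AppendixC.TowerMorphism
import HarnessLib

/-!
# [Liu 2021, Thm 4.15 / 4.18] receptacle: the IDENTITY morphism of towers (non-vacuity witness of `TowerHom` / `EtaleTowerHom`)

Topic `NumberTheory/Automorphic/Liu2021/AppendixC`; namespace `Literature.NumberTheory.Automorphic.Liu2021.AppendixC`.
Real definitions + bookkeeping theorems; NO named fact, NO instance, NO notation, NO `sorry`; net Literature debt 0.
Cell `hodgecm-mathlib`, crux `HLiu418` (stmt-HodgeConjecture-24832), typer row T2-R3 follow-up K-a of the cell's KEY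
`t2r2prime-tower-lift-and-refl` (A-plan1 g6): the receptacle ★ `Sec42Data.TowerHom Cₛ C Tₛ T φ hφ` /
`Sec42Data.EtaleTowerHom …` (`TowerMorphism.lean`, ★ p640334) is INHABITED at `Cₛ = C`, `Tₛ = T`, `φ = MonoidHom.id` — the
identity morphism of Shimura data induces the identity on the canonical models ([Milne2005ShimuraVarieties] Thm. 13.6 /
Rem. 13.8 at `φ = id`; [Deligne1971TravauxShimura] §5 (5.4)), read on the tower as the TRANSITION morphisms
`T_1 = u : X_{K ∩ K₀} ⟶ X_K` of [Liu2021] §4.2 l. 2062–2064 (the pull-back level `id⁻¹K ∩ K₀` IS `K`, as subgroups).  This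
certifies that the fields of both hypothesis structures are jointly satisfiable (BC hygiene for every `∀ M : EtaleTowerHom …`
consumer and for the T2-R2′ existence binder of the a3_liu418 line).

## Contents

* §1 `C5.pullbackLevel_id_le` / `C5.le_pullbackLevel_id` — `id⁻¹K ∩ K₀ = K` as two inequalities of small levels (no `cast`).
* §2 **`Sec42Data.TowerHom.refl C T`** — `map K := T_1 : X_{id⁻¹K ∩ K₀} ⟶ X_K` (the Hecke translate at `g = 1`, a genuine
  morphism between the two index objects; NO `eqToHom`), `map_tr` from `T_g ≫ T_{g'} = T_{gg'}` (`tr_mul`, `map_comp_tr`,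
  `tr_congr`: `1·g = g·1`); `refl_map` (rfl), `refl_map_eq_map` (`= u`), `refl_albMap` (`Alb(map K) = Alb_u`).
* §3 **`Sec42Data.EtaleTowerHom.refl C T`** — `etPull ℓ := LinearMap.id`; the defining square is ★ `toTower_pull`
  (`[ᵗV_ℓ(Alb_u) ψ]_{K ∩ K₀} = [ψ]_K`); `refl_etPull` (rfl).
* §4 `nonempty_towerHom_refl`, **`nonempty_etaleTowerHom_refl`** — the receptacle is inhabited.

## References
* [Milne2005ShimuraVarieties] J. S. Milne, *Introduction to Shimura varieties* (2005), Thm. 13.6 p. 118, Rem. 13.8 p. 119,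
  §5 p. 57–58.
* [Deligne1971TravauxShimura] P. Deligne, *Travaux de Shimura*, Sém. Bourbaki 389 (1971), §5 (5.4).
* [Liu2021] Y. Liu, Camb. J. Math. 9 (2021) = arXiv:2102.11518, §4.2 l. 2062–2074, §4.3 l. 2152–2160.
-/

set_option autoImplicit false

noncomputable section

open CategoryTheory NumberField
open scoped TensorProduct

namespace Literature.NumberTheory.Automorphic.Liu2021.AppendixC

open Literature.AlgebraicGeometry.Motives (AbelianVariety)
open Literature.AlgebraicGeometry.Motives.AbelianVariety (rationalTateModuleMap)

/-! ## §1 The pull-back level along the identity is the level itself -/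

namespace C5

variable {H : Type} [Group H] [TopologicalSpace H] [IsTopologicalGroup H] {K₀ : OpenCompactSubgroup H}

/-- `id⁻¹(K) ∩ K₀ ⊆ K`. [cite: Milne2005ShimuraVarieties, Rem. 13.8 p. 119 and Thm. 13.6 p. 118] -/
theorem pullbackLevel_id_le (K : SmallLevel K₀) : pullbackLevel (MonoidHom.id H) continuous_id K₀ K ≤ K := by
  show (pullbackLevel (MonoidHom.id H) continuous_id K₀ K).1.1 ≤ K.1.1
  intro k hk
  exact ((mem_pullbackLevel_iff (MonoidHom.id H) continuous_id K k).1 hk).1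

/-- `K ⊆ id⁻¹(K) ∩ K₀` (a small level lies in `K₀`). [cite: Milne2005ShimuraVarieties, Rem. 13.8 p. 119 and Thm. 13.6 p. 118] -/
theorem le_pullbackLevel_id (K : SmallLevel K₀) : K ≤ pullbackLevel (MonoidHom.id H) continuous_id K₀ K := by
  show K.1.1 ≤ (pullbackLevel (MonoidHom.id H) continuous_id K₀ K).1.1
  intro k hk
  exact (mem_pullbackLevel_iff (MonoidHom.id H) continuous_id K k).2 ⟨hk, K.2 hk⟩

/-- The level condition at `g = 1` from the pull-back level along `id` to the level. [cite: Milne2005ShimuraVarieties, §13 p. 118 L21] -/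
theorem heckeLE_one_pullbackLevel_id (K : SmallLevel K₀) :
    HeckeLE (1 : H) (pullbackLevel (MonoidHom.id H) continuous_id K₀ K) K :=
  HeckeLE.one_of_le (pullbackLevel_id_le K)

end C5

/-! ## §2 The identity morphism of towers -/

section Sec42

variable {F E : Type} [Field F] [NumberField F] [IsTotallyReal F] [Field E] [NumberField E] [Algebra F E]
  [IsTotallyComplex E] [Algebra.IsQuadraticExtension F E]
variable {P5 : PropC5Data F E} {iso : ℕ → Prop}

/-- **The identity morphism of towers** `{X_K}_K → {X_K}_K` along `φ = id` ([Milne2005ShimuraVarieties] Thm. 13.6 / Rem. 13.8 at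
the identity morphism of Shimura data; [Liu2021] §4.2 l. 2062–2064): `map K := T_1 : X_{id⁻¹K ∩ K₀} ⟶ X_K`, the Hecke translate
at `g = 1` (= the transition morphism `u`, `tr_one`), and the compatibility `u ≫ T_1 ≫ T_g = T_g ≫ T_1` from `T_g ≫ T_{g'} = T_{gg'}`.
No `eqToHom`: the two index objects `id⁻¹K ∩ K₀` and `K` are related by a genuine morphism.
[cite: Milne2005ShimuraVarieties, Thm. 13.6 p. 118 and Rem. 13.8 p. 119] [cite: Liu2021, §4.2 l. 2062–2074] -/
def Sec42Data.TowerHom.refl (C : Sec42Data P5 iso) (T : C.HeckeTranslates) :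
    Sec42Data.TowerHom C C T T (MonoidHom.id C.G) continuous_id where
  map K := T.tr 1 (C5.pullbackLevel (MonoidHom.id C.G) continuous_id C.S.K₀ K) K (C5.heckeLE_one_pullbackLevel_id K)
  map_tr g L K h Lₛ hₛ hL := by
    rw [← Category.assoc, T.map_comp_tr, T.tr_mul, T.tr_mul]
    exact T.tr_congr (by rw [MonoidHom.id_apply, one_mul, mul_one]) _ _

namespace Sec42Data.TowerHom

variable (C : Sec42Data P5 iso) (T : C.HeckeTranslates)

/-- Unfolding: `(refl C T).map K = T_1`. [cite: Milne2005ShimuraVarieties, Thm. 13.6 p. 118] -/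
theorem refl_map (K : C5.SmallLevel C.S.K₀) :
    (refl C T).map K =
      T.tr 1 (C5.pullbackLevel (MonoidHom.id C.G) continuous_id C.S.K₀ K) K (C5.heckeLE_one_pullbackLevel_id K) :=
  rfl

/-- `(refl C T).map K` is the transition morphism `u : X_{id⁻¹K ∩ K₀} ⟶ X_K` of the compactified system (`tr_one`).
[cite: Liu2021, §4.2 l. 2062–2064] [cite: Milne2005ShimuraVarieties, §5 p. 58 L3–6] -/
theorem refl_map_eq_map (K : C5.SmallLevel C.S.K₀) :
    (refl C T).map K = C.cpt.X.map (homOfLE (C5.pullbackLevel_id_le K)) := by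
  rw [refl_map, ← T.tr_one (homOfLE (C5.pullbackLevel_id_le K))]

/-- `Alb((refl C T).map K) = Alb_u`, the transition homomorphism of `{A_K}_K` (`albTr_one`).
[cite: Liu2021, §4.2 l. 2070 and Def. 2.3 l. 1206–1208] -/
theorem refl_albMap (K : C5.SmallLevel C.S.K₀) :
    (refl C T).albMap K = C.Atr (homOfLE (C5.pullbackLevel_id_le K)) := by
  rw [albMap, refl_map_eq_map, ← C.Atr_eq_map]

/-- The level pull-back of the identity morphism is the transition map `ᵗV_ℓ(Alb_u)` of the `ℓ`-adic system.
[cite: Liu2021, §4.3 l. 2158] -/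
theorem refl_etPullLevel (ℓ : ℕ) [Fact ℓ.Prime] (K : C5.SmallLevel C.S.K₀) :
    (refl C T).etPullLevel ℓ K = (rationalTateModuleMap ℓ (C.Atr (homOfLE (C5.pullbackLevel_id_le K)))).dualMap := by
  rw [etPullLevel, refl_albMap]

end Sec42Data.TowerHom

/-! ## §3 The identity étale receptacle -/

/-- **The identity morphism of towers with its pull-back on `H¹_ét(A_∞)`**: `etPull ℓ := id`; the defining square
`[ψ]_K = [ᵗV_ℓ(Alb_u) ψ]_{id⁻¹K ∩ K₀}` is the compatibility of the canonical maps into the colimit with the transition maps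
(★ `Sec42Data.toTower_pull`). [cite: Liu2021, §4.3 l. 2152–2160] [cite: Milne2005ShimuraVarieties, Thm. 13.6 p. 118 and Rem. 13.8 p. 119] -/
def Sec42Data.EtaleTowerHom.refl (C : Sec42Data P5 iso) (T : C.HeckeTranslates) :
    Sec42Data.EtaleTowerHom C C T T (MonoidHom.id C.G) continuous_id where
  toTowerHom := Sec42Data.TowerHom.refl C T
  etPull ℓ _ := LinearMap.id
  etPull_toTower ℓ _ K ψ := by
    have h : (C.alb (C5.pullbackLevel (MonoidHom.id C.G) continuous_id C.S.K₀ K)).map (C.alb K)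
        ((Sec42Data.TowerHom.refl C T).map K) = C.Atr (homOfLE (C5.pullbackLevel_id_le K)) :=
      Sec42Data.TowerHom.refl_albMap C T K
    rw [LinearMap.id_apply, h, C.toTower_pull]

namespace Sec42Data.EtaleTowerHom

variable (C : Sec42Data P5 iso) (T : C.HeckeTranslates)

/-- Unfolding: the identity receptacle pulls back by the identity. [cite: Liu2021, §4.3 l. 2158] -/
theorem refl_etPull (ℓ : ℕ) [Fact ℓ.Prime] : (refl C T).etPull ℓ = LinearMap.id := rfl

/-- Unfolding: the geometric datum of the identity receptacle is `TowerHom.refl`. [cite: Milne2005ShimuraVarieties, Thm. 13.6 p. 118] -/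
theorem refl_toTowerHom : (refl C T).toTowerHom = Sec42Data.TowerHom.refl C T := rfl

/-- Unfolding: `(refl C T).map K = T_1`. [cite: Milne2005ShimuraVarieties, Thm. 13.6 p. 118] -/
theorem refl_map (K : C5.SmallLevel C.S.K₀) :
    (refl C T).map K =
      T.tr 1 (C5.pullbackLevel (MonoidHom.id C.G) continuous_id C.S.K₀ K) K (C5.heckeLE_one_pullbackLevel_id K) :=
  rfl

end Sec42Data.EtaleTowerHom

/-! ## §4 Non-vacuity of the receptacle -/

/-- **The geometric receptacle is inhabited** (at `φ = id`). [cite: Milne2005ShimuraVarieties, Thm. 13.6 p. 118 and Rem. 13.8 p. 119] -/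
theorem nonempty_towerHom_refl (C : Sec42Data P5 iso) (T : C.HeckeTranslates) :
    Nonempty (Sec42Data.TowerHom C C T T (MonoidHom.id C.G) continuous_id) :=
  ⟨Sec42Data.TowerHom.refl C T⟩

/-- **The étale receptacle is inhabited** (at `φ = id`): the fields `map`, `map_tr`, `etPull`, `etPull_toTower` of
`Sec42Data.EtaleTowerHom` are jointly satisfiable for every §4.2 datum with Hecke translates — the BC-hygiene witness for every
`∀ M : Sec42Data.EtaleTowerHom …` consumer. [cite: Milne2005ShimuraVarieties, Thm. 13.6 p. 118 and Rem. 13.8 p. 119] [cite: Liu2021, §4.3 l. 2152–2160] -/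
theorem nonempty_etaleTowerHom_refl (C : Sec42Data P5 iso) (T : C.HeckeTranslates) :
    Nonempty (Sec42Data.EtaleTowerHom C C T T (MonoidHom.id C.G) continuous_id) :=
  ⟨Sec42Data.EtaleTowerHom.refl C T⟩

/-! ## §5 Elaboration checks: the derived theorems of the receptacle specialise at the identity -/

/-- `Γ_E`-equivariance of the identity pull-back (★ `etPull_towerRep`, here trivially). -/
example (C : Sec42Data P5 iso) (T : C.HeckeTranslates) (ℓ : ℕ) [Fact ℓ.Prime] (σ : Field.absoluteGaloisGroup E) :
    (Sec42Data.EtaleTowerHom.refl C T).etPull ℓ ∘ₗ C.towerRep ℓ σ =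
      C.towerRep ℓ σ ∘ₗ (Sec42Data.EtaleTowerHom.refl C T).etPull ℓ :=
  (Sec42Data.EtaleTowerHom.refl C T).etPull_towerRep ℓ σ

/-- Uniqueness: any étale receptacle over the identity geometric datum pulls back by the identity (★ `etPull_unique`). -/
example (C : Sec42Data P5 iso) (T : C.HeckeTranslates) (ℓ : ℕ) [Fact ℓ.Prime]
    (M' : Sec42Data.EtaleTowerHom C C T T (MonoidHom.id C.G) continuous_id)
    (h : M'.map = (Sec42Data.EtaleTowerHom.refl C T).map) : M'.etPull ℓ = LinearMap.id :=
  (Sec42Data.EtaleTowerHom.refl C T).etPull_unique ℓ M' h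

end Sec42

end Literature.NumberTheory.Automorphic.Liu2021.AppendixC

end
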